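import Summits.ResolutionOfSingularities.ResolutionOfSingularities.Theorems.PurelyInseparableDim4Target
import Summits.ResolutionOfSingularities.ResolutionOfSingularities.Theorems.PurelyInseparableDim4Rules
import Summits.ResolutionOfSingularities.ResolutionOfSingularities.Theorems.PurelyInseparableDim4Scope
import Literature.AlgebraicGeometry.Resolution.CentreBlowupOrdAlongBasics
import Literature.AlgebraicGeometry.Resolution.CentreBlowupMohStability
import Literature.RingTheory.MvPolynomial.VariableIdeals
import Mathlib.RingTheory.Ideal.MinimalPrime.Basic
import HarnessLib
import HarnessLib.Audit.Tags

/-!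
# Purely inseparable four-folds — the ISOLATED regime is rule-independent (cell `res-dim4-pi`, PR-8)

[OURS · counted 0 · a statement about OUR candidate frame, not about resolution of singularities]
Brick PR-8 of the cell's wave-2 table (`boards/WAVE2.md` §F, desk WORD #20 (c) / frame v4):
the frame statement F4-C `PIDim4.TerminatesInScope p q` implies F4-I `PIDim4.NoIsolatedTrap p q`.

The mathematics is one piece of bookkeeping about the ideal `J_q⁺(F) = ⟨D^{(α)}F : 0 < |α| < q⟩`
of the `q`-fold locus (`PIDim4.singLocusIdeal`):

* §2 **`singLocusIdeal_le_span_X`** — if `V(z, x_S)` is Hironaka-permissible for `z^q + F`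
  (`q ≤ ord_{(x_S)} F`, i.e. every monomial of `F` has `S`-degree `≥ q`), then every Hasse
  derivative `D^{(α)}F` with `|α| < q` lies in the coordinate prime `(xᵢ : i ∈ S)`: each of its
  monomials `x^{d−α}` keeps `S`-degree `≥ q − |α| ≥ 1`.  Hence `J_q⁺(F) ≤ (x_S)`.
* §3 **`eq_univ_of_isIsolated`** — at an ISOLATED `q`-fold point (`PIDim4.IsIsolated`: every
  minimal prime of `J_q⁺(F)` inside `𝔪₀` is `𝔪₀`) the only permissible coordinate centre is the
  point: `(x_S)` is prime (`Literature.RingTheory.MvPolynomial.isPrime_span_X_image`), so it contains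
  a minimal prime of `J_q⁺(F)` (`Ideal.exists_minimalPrimes_le`), which is `𝔪₀`; then every `xᵢ`
  lies in `(x_S)`, i.e. `S = {1,…,4}`.
* §4 consequently, at isolated states MODE 0 / MODE 1h / MODE 2 / every permissible `CentreRule`
  have the SAME steps (`step1h_iff_step0_of_isIsolated`, `stepRule_iff_step0_of_isIsolated`, …),
  and an isolated state is in coordinate scope (`inCoordinateScope_of_isIsolated`).
* §5 the frame implications: **`terminatesInScope_imp_noIsolatedTrap`** (PR-8 as worded by the
  desk), `terminatesSomeRule_imp_noIsolatedTrap`, `terminates1h_imp_noIsolatedTrap`, and the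
  rule-independence `noIsolatedTrap_iff_forall_rule`; §6 Taylor at the origin
  (`eval_zero_hasseDeriv`): `J_q⁺(F) ≤ 𝔪₀` iff the coefficients of `F` in degrees `0 < |α| < q`
  vanish — for cleaned `F` exactly the `q`-fold-origin clause of `Step0`.

Nothing here proves `NoIsolatedTrap p q` itself, and nothing here is a theorem about resolution of
singularities in dimension ≥ 4 / characteristic `p` (NOT proved anywhere in this programme).
bears_on: LADDER-RESOLUTION:D157-DOOR2 (res-dim4-pi · PR-8). Supports
stmt-ResolutionOfSingularities-16155 (helper).
-/

set_option linter.dupNamespace false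

namespace Summit.ResolutionOfSingularities.ResolutionOfSingularities.Theorems.PIDim4

namespace IsolatedScope

open MvPolynomial Finset
open Literature.AlgebraicGeometry.Resolution
open Literature.RingTheory.MvPolynomial

variable {K : Type} [Field K]

/-! ## 1. The origin ideal `𝔪₀` and the coordinate ideals `(xᵢ : i ∈ S)` -/

/-- `f ∈ 𝔪₀` iff the constant term of `f` vanishes. [folklore] -/
theorem mem_originIdeal_iff {f : MvPolynomial (Fin 4) K} :
    f ∈ originIdeal K ↔ constantCoeff f = 0 := by
  rw [originIdeal, RingHom.mem_ker, MvPolynomial.eval_zero]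

/-- Every variable lies in `𝔪₀`. [folklore] -/
theorem X_mem_originIdeal (i : Fin 4) : (X i : MvPolynomial (Fin 4) K) ∈ originIdeal K := by
  rw [mem_originIdeal_iff, constantCoeff_X]

/-- `(xᵢ : i ∈ S) ≤ 𝔪₀`. [folklore] -/
theorem span_X_image_le_originIdeal (S : Set (Fin 4)) :
    Ideal.span ((fun i => (X i : MvPolynomial (Fin 4) K)) '' S) ≤ originIdeal K := by
  rw [Ideal.span_le]
  rintro _ ⟨i, -, rfl⟩
  exact X_mem_originIdeal i

/-- `𝔪₀ = (x₁, x₂, x₃, x₄)`. [folklore] -/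
theorem originIdeal_eq_span_X :
    originIdeal K = Ideal.span ((fun i => (X i : MvPolynomial (Fin 4) K)) ''
      ((Finset.univ : Finset (Fin 4)) : Set (Fin 4))) := by
  apply le_antisymm
  · intro f hf
    rw [mem_originIdeal_iff] at hf
    rw [Finset.coe_univ]
    refine MvPolynomial.mem_ideal_span_X_image.mpr fun m hm => ?_
    have hm0 : m ≠ 0 := by
      rintro rfl
      exact (MvPolynomial.mem_support_iff.mp hm) hf
    obtain ⟨i, hi⟩ := DFunLike.ne_iff.mp hm0
    exact ⟨i, Set.mem_univ i, hi⟩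
  · exact span_X_image_le_originIdeal _

/-- `𝔪₀` is a coordinate ideal (`S = {1, …, 4}`). [folklore] -/
theorem isCoordinateIdeal_originIdeal : IsCoordinateIdeal (originIdeal K) :=
  ⟨Finset.univ, originIdeal_eq_span_X⟩

/-! ## 2. Permissibility of `V(z, x_S)` puts `J_q⁺(F)` inside `(x_S)` -/

/-- If every monomial of `F` has `S`-degree `≥ q` and `|α| < q`, the Hasse derivative `D^{(α)} F`
lies in `(xᵢ : i ∈ S)`: the monomial `x^{d − α}` of `D^{(α)}(x^d)` has `S`-degree
`≥ Σ_{i∈S} dᵢ − |α| ≥ 1`. [cite: Giraud1975, §1 (Hasse–Schmidt derivations)] [folklore] -/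
theorem hasseDeriv_mem_span_X {q : ℕ} {S : Finset (Fin 4)} {F : MvPolynomial (Fin 4) K}
    (hq : (q : ℕ∞) ≤ CentreBlowup.ordAlong S F) {α : Fin 4 →₀ ℕ} (hα : α.degree < q) :
    hasseDeriv α F ∈ Ideal.span ((fun i => (X i : MvPolynomial (Fin 4) K)) '' (S : Set (Fin 4))) := by
  unfold hasseDeriv
  refine Ideal.sum_mem _ fun d hd => ?_
  refine MvPolynomial.mem_ideal_span_X_image.mpr fun m hm => ?_
  have hm' : m = d - α := Finset.mem_singleton.mp (MvPolynomial.support_monomial_subset hm)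
  subst hm'
  by_contra hcon
  push Not at hcon
  have hle : CentreBlowup.degIn S d ≤ CentreBlowup.degIn S α := by
    unfold CentreBlowup.degIn
    refine Finset.sum_le_sum fun i hi => ?_
    have h := hcon i (Finset.mem_coe.mpr hi)
    rw [Finsupp.tsub_apply] at h
    omega
  have hqd : q ≤ CentreBlowup.degIn S d := by exact_mod_cast (CentreBlowup.le_ordAlong_iff.mp hq) d hd
  have hαdeg : CentreBlowup.degIn S α ≤ α.degree := CentreBlowup.degIn_le_degree S α
  omega

/-- **`J_q⁺(F) ≤ (x_S)` whenever `V(z, x_S)` is Hironaka-permissible** (`q ≤ ord_{(x_S)} F`): the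
`q`-fold locus contains the centre, read on ideals. [cite: Giraud1975, §1] [folklore] -/
theorem singLocusIdeal_le_span_X {q : ℕ} {S : Finset (Fin 4)} {F : MvPolynomial (Fin 4) K}
    (hq : (q : ℕ∞) ≤ CentreBlowup.ordAlong S F) :
    singLocusIdeal q F ≤ Ideal.span ((fun i => (X i : MvPolynomial (Fin 4) K)) '' (S : Set (Fin 4))) := by
  unfold singLocusIdeal
  rw [Ideal.span_le]
  rintro G ⟨α, -, hαq, rfl⟩
  exact hasseDeriv_mem_span_X hq hαq

/-- A `q`-fold origin (`q ≤ ord₀ F`, as in `Step0`) has `J_q⁺(F) ≤ 𝔪₀`. [folklore] -/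
theorem singLocusIdeal_le_originIdeal_of_le_ordAlong_univ {q : ℕ} {F : MvPolynomial (Fin 4) K}
    (hq : (q : ℕ∞) ≤ CentreBlowup.ordAlong Finset.univ F) :
    singLocusIdeal q F ≤ originIdeal K :=
  (singLocusIdeal_le_span_X hq).trans (span_X_image_le_originIdeal _)

/-! ## 3. At an isolated `q`-fold point the only permissible coordinate centre is the point -/

/-- **Isolated ⇒ point only.** If the origin is an ISOLATED `q`-fold point of `z^q + F` and
`V(z, x_S)` is Hironaka-permissible (`q ≤ ord_{(x_S)} F`), then `S = {1, …, 4}`: the prime `(x_S)`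
contains `J_q⁺(F)`, hence a minimal prime of it, which is `𝔪₀` by isolation; so every `xᵢ ∈ (x_S)`.
[folklore] -/
theorem eq_univ_of_isIsolated {q : ℕ} {S : Finset (Fin 4)} {F : MvPolynomial (Fin 4) K}
    (hiso : IsIsolated q F) (hq : (q : ℕ∞) ≤ CentreBlowup.ordAlong S F) : S = Finset.univ := by
  haveI hprime : (Ideal.span ((fun i => (X i : MvPolynomial (Fin 4) K)) '' (S : Set (Fin 4)))).IsPrime :=
    isPrime_span_X_image (S : Set (Fin 4))
  obtain ⟨P, hPmin, hPS⟩ := Ideal.exists_minimalPrimes_le (singLocusIdeal_le_span_X hq)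
  have hP0 : P ≤ originIdeal K := hPS.trans (span_X_image_le_originIdeal _)
  have hPeq : P = originIdeal K := hiso.2 P hPmin hP0
  refine Finset.eq_univ_of_forall fun i => ?_
  have hXi : (X i : MvPolynomial (Fin 4) K) ∈
      Ideal.span ((fun i => (X i : MvPolynomial (Fin 4) K)) '' (S : Set (Fin 4))) :=
    hPS (hPeq ▸ X_mem_originIdeal i)
  exact Finset.mem_coe.mp (X_mem_span_X_image_iff.mp hXi)

/-- At an isolated `q`-fold origin, `V(z, x_S)` is a permissible centre iff `S` is the point.
[folklore] -/
theorem isPermissibleCentre_iff_eq_univ_of_isIsolated {q : ℕ} {S : Finset (Fin 4)}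
    {F : MvPolynomial (Fin 4) K} (hiso : IsIsolated q F)
    (h0 : (q : ℕ∞) ≤ CentreBlowup.ordAlong Finset.univ F) :
    IsPermissibleCentre q S F ↔ S = Finset.univ := by
  constructor
  · exact fun h => eq_univ_of_isIsolated hiso h.2
  · rintro rfl
    exact ⟨Finset.univ_nonempty, h0⟩

/-- At an isolated `q`-fold origin, the MODE-1h centre is the point (and only the point). [folklore] -/
theorem isMode1hCentre_iff_eq_univ_of_isIsolated {q : ℕ} {S : Finset (Fin 4)}
    {F : MvPolynomial (Fin 4) K} (hiso : IsIsolated q F)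
    (h0 : (q : ℕ∞) ≤ CentreBlowup.ordAlong Finset.univ F) :
    IsMode1hCentre q S F ↔ S = Finset.univ := by
  constructor
  · exact fun h => eq_univ_of_isIsolated hiso h.1.2
  · rintro rfl
    refine ⟨⟨Finset.univ_nonempty, h0⟩, fun S' hS' => ?_⟩
    rw [eq_univ_of_isIsolated hiso hS'.2]

/-- An isolated `q`-fold point is in coordinate scope (its only locus component through the point
is the point, `V(𝔪₀) = V(x₁,…,x₄)`). [folklore] -/
theorem inCoordinateScope_of_isIsolated {q : ℕ} {F : MvPolynomial (Fin 4) K}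
    (hiso : IsIsolated q F) : InCoordinateScope q F :=
  fun P hP hP0 => (hiso.2 P hP hP0) ▸ isCoordinateIdeal_originIdeal

/-! ## 4. At isolated states every mode takes the same step -/

/-- The point rule `s ↦ {1,…,4}` is a permissible rule: if any `V(z, x_S)` is permissible then so is
the point (`ord_{(x_S)} F ≤ ord₀ F`). [folklore] -/
theorem isPermissibleRule_point (q : ℕ) :
    IsPermissibleRule q (fun _ : State K => (Finset.univ : Finset (Fin 4))) := by
  rintro s ⟨S, -, hS⟩
  exact ⟨Finset.univ_nonempty, hS.trans (CentreBlowup.ordAlong_mono (Finset.subset_univ S) s.F)⟩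

/-- A permissible rule picks the point at an isolated `q`-fold state. [folklore] -/
theorem rule_eq_univ_of_isIsolated {q : ℕ} (R : CentreRule K) (hR : IsPermissibleRule q R)
    {s : State K} (hiso : IsIsolated q s.F)
    (h0 : (q : ℕ∞) ≤ CentreBlowup.ordAlong Finset.univ s.F) : R s = Finset.univ :=
  eq_univ_of_isIsolated hiso (hR s ⟨Finset.univ, Finset.univ_nonempty, h0⟩).2

section Steps

variable [DecidableEq K]

/-- At an isolated state, a MODE-0 (point) step is a step of every permissible rule. [folklore] -/
theorem stepRule_of_step0 {q : ℕ} (R : CentreRule K) (hR : IsPermissibleRule q R)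
    {s s' : State K} (hiso : IsIsolated q s.F) (h : Step0 q s s') : StepRule q R s s' := by
  obtain ⟨h0, hedge⟩ := h
  have hperm : IsPermissibleCentre q (R s) s.F := hR s ⟨Finset.univ, Finset.univ_nonempty, h0⟩
  refine ⟨hperm, ?_⟩
  rw [eq_univ_of_isIsolated hiso hperm.2]
  exact hedge

/-- At an isolated state, the steps of any permissible rule are exactly the point steps. [folklore] -/
theorem stepRule_iff_step0_of_isIsolated {q : ℕ} (R : CentreRule K) (hR : IsPermissibleRule q R)
    {s s' : State K} (hiso : IsIsolated q s.F) : StepRule q R s s' ↔ Step0 q s s' := by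
  constructor
  · rintro ⟨hperm, hedge⟩
    have hRs : R s = Finset.univ := eq_univ_of_isIsolated hiso hperm.2
    refine ⟨?_, ?_⟩
    · rw [← hRs]; exact hperm.2
    · rw [← hRs]; exact hedge
  · exact stepRule_of_step0 R hR hiso

/-- At an isolated state, MODE-1h steps are exactly the point steps. [folklore] -/
theorem step1h_iff_step0_of_isIsolated {q : ℕ} {s s' : State K} (hiso : IsIsolated q s.F) :
    Step1h q s s' ↔ Step0 q s s' := by
  constructor
  · rintro ⟨S, hS, hedge⟩
    have hS' : S = Finset.univ := eq_univ_of_isIsolated hiso hS.1.2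
    subst hS'
    exact ⟨hS.1.2, hedge⟩
  · rintro ⟨h0, hedge⟩
    exact ⟨Finset.univ, (isMode1hCentre_iff_eq_univ_of_isIsolated hiso h0).mpr rfl, hedge⟩

/-- At an isolated state, MODE-2 steps (any permissible coordinate centre) are exactly the point
steps. [folklore] -/
theorem step2_iff_step0_of_isIsolated {q : ℕ} {s s' : State K} (hiso : IsIsolated q s.F) :
    Step2 q s s' ↔ Step0 q s s' := by
  constructor
  · rintro ⟨S, hS, hedge⟩
    have hS' : S = Finset.univ := eq_univ_of_isIsolated hiso hS.2
    subst hS'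
    exact ⟨hS.2, hedge⟩
  · rintro ⟨h0, hedge⟩
    exact ⟨Finset.univ, ⟨Finset.univ_nonempty, h0⟩, hedge⟩

/-- At an isolated state, an HP-permissible step (conditions (1) ∧ (2)) is a point step. [folklore] -/
theorem step0_of_stepHP_of_isIsolated {q : ℕ} {s s' : State K} (hiso : IsIsolated q s.F)
    (h : StepHP q s s') : Step0 q s s' := by
  obtain ⟨S, hS, -, hedge⟩ := h
  have hS' : S = Finset.univ := eq_univ_of_isIsolated hiso hS.2
  subst hS'
  exact ⟨hS.2, hedge⟩

end Steps

/-! ## 5. Frame v4: F4-C ⇒ F4-I, and the isolated regime is rule-independent -/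

/-- **PR-8 (desk wording): `TerminatesInScope p q → NoIsolatedTrap p q`.**  An infinite branch of
point blow-ups through ISOLATED `q`-fold states is, for every permissible coordinate rule `R`, an
infinite `R`-branch inside the coordinate scope — which F4-C forbids for some `R`.
[OURS · frame v4 bookkeeping; not a statement about resolution of singularities] [folklore] -/
theorem terminatesInScope_imp_noIsolatedTrap (p q : ℕ) (h : TerminatesInScope p q) :
    NoIsolatedTrap p q := by
  intro K _ _ _
  rintro ⟨c, hc⟩
  obtain ⟨R, hR, hT⟩ := h K
  exact hT ⟨c, fun k =>
    ⟨inCoordinateScope_of_isIsolated (hc k).1, stepRule_of_step0 R hR (hc k).1 (hc k).2⟩⟩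

/-- `TerminatesSomeRule p q → NoIsolatedTrap p q` (through `terminatesInScope_of_terminatesSomeRule`).
Vacuous at `(p, q) = (2, 2)`, where `TerminatesSomeRule 2 2` is refuted by the cell's TRAP-1.
[OURS] [folklore] -/
theorem terminatesSomeRule_imp_noIsolatedTrap (p q : ℕ) (h : TerminatesSomeRule p q) :
    NoIsolatedTrap p q :=
  terminatesInScope_imp_noIsolatedTrap p q (terminatesInScope_of_terminatesSomeRule p q h)

/-- `Terminates1h p q → NoIsolatedTrap p q`: an isolated point-blow-up branch is a MODE-1h branch.
Vacuous at `(2, 2)` (`not_terminates1h_two`). [OURS] [folklore] -/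
theorem terminates1h_imp_noIsolatedTrap (p q : ℕ) (h : Terminates1h p q) : NoIsolatedTrap p q := by
  intro K _ _ _
  rintro ⟨c, hc⟩
  exact h K ⟨c, fun k => (step1h_iff_step0_of_isIsolated (hc k).1).mpr (hc k).2⟩

/-- No infinite isolated branch under a rule `R` that terminates (one field). [OURS] [folklore] -/
theorem no_isolated_branch_of_terminatesUnder {K : Type} [Field K] [DecidableEq K] {q : ℕ}
    (R : CentreRule K) (hR : IsPermissibleRule q R) (hT : TerminatesUnder q R) :
    ¬ ∃ c : ℕ → State K, ∀ k, IsIsolated q (c k).F ∧ Step0 q (c k) (c (k + 1)) := by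
  rintro ⟨c, hc⟩
  exact hT ⟨c, fun k => stepRule_of_step0 R hR (hc k).1 (hc k).2⟩

/-- **The isolated regime is rule-independent**: F4-I holds iff for every field of characteristic
`p` and EVERY permissible coordinate rule `R` there is no infinite `R`-branch through isolated
`q`-fold states (the point rule witnesses the converse). [OURS] [folklore] -/
theorem noIsolatedTrap_iff_forall_rule (p q : ℕ) :
    NoIsolatedTrap p q ↔
      ∀ (K : Type) [Field K] [CharP K p] [DecidableEq K] (R : CentreRule K),
        IsPermissibleRule q R →
          ¬ ∃ c : ℕ → State K, ∀ k, IsIsolated q (c k).F ∧ StepRule q R (c k) (c (k + 1)) := by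
  constructor
  · intro h K _ _ _ R hR
    rintro ⟨c, hc⟩
    exact h K ⟨c, fun k =>
      ⟨(hc k).1, (stepRule_iff_step0_of_isIsolated R hR (hc k).1).mp (hc k).2⟩⟩
  · intro h K _ _ _
    rintro ⟨c, hc⟩
    exact h K (fun _ => Finset.univ) (isPermissibleRule_point q)
      ⟨c, fun k => ⟨(hc k).1, stepRule_of_step0 _ (isPermissibleRule_point q) (hc k).1 (hc k).2⟩⟩

/-! ## 6. Taylor coefficients: what the first clause of `IsIsolated` says about `F` -/

/-- **Taylor at the origin**: `(D^{(α)} F)(0) = coeff_α F`.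
[cite: Giraud1975, §1 (Hasse–Schmidt derivations)] [folklore] -/
theorem eval_zero_hasseDeriv (α : Fin 4 →₀ ℕ) (F : MvPolynomial (Fin 4) K) :
    MvPolynomial.eval (0 : Fin 4 → K) (hasseDeriv α F) = coeff α F := by
  classical
  unfold hasseDeriv
  rw [MvPolynomial.eval_zero, map_sum]
  have key : ∀ d ∈ F.support,
      constantCoeff (monomial (d - α) ((∏ i, (Nat.choose (d i) (α i) : K)) * coeff d F)) =
        if d = α then coeff d F else 0 := by
    intro d _
    rw [constantCoeff_monomial]
    by_cases hdα : d = α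
    · subst hdα
      simp only [tsub_self, if_true, Nat.choose_self, Nat.cast_one, Finset.prod_const_one, one_mul]
    · rw [if_neg hdα]
      split_ifs with h0
      · have hlt : ∃ i, d i < α i := by
          by_contra hcon
          push Not at hcon
          apply hdα
          ext i
          have h1 : d i - α i = 0 := by
            have h2 := DFunLike.congr_fun h0 i
            rwa [Finsupp.tsub_apply] at h2
          have h3 := hcon i
          omega
        obtain ⟨i, hi⟩ := hlt
        rw [Finset.prod_eq_zero (Finset.mem_univ i)
          (by rw [Nat.choose_eq_zero_of_lt hi, Nat.cast_zero]), zero_mul]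
      · rfl
  rw [Finset.sum_congr rfl key, Finset.sum_ite_eq' F.support α (fun d => coeff d F)]
  split_ifs with hα
  · rfl
  · exact (MvPolynomial.notMem_support_iff.mp hα).symm

/-- A Hasse derivative lies in `𝔪₀` iff the corresponding Taylor coefficient vanishes. [folklore] -/
theorem hasseDeriv_mem_originIdeal_iff (α : Fin 4 →₀ ℕ) (F : MvPolynomial (Fin 4) K) :
    hasseDeriv α F ∈ originIdeal K ↔ coeff α F = 0 := by
  rw [originIdeal, RingHom.mem_ker, eval_zero_hasseDeriv]

/-- **`J_q⁺(F) ≤ 𝔪₀` iff every coefficient of `F` in degrees `0 < |α| < q` vanishes** — the origin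
is a `q`-fold point of `z^q + F` up to the constant term `F(0)`, which `z ↦ z + c` (cleaning)
absorbs (cell note T-ISO-1). [folklore] -/
theorem singLocusIdeal_le_originIdeal_iff {q : ℕ} {F : MvPolynomial (Fin 4) K} :
    singLocusIdeal q F ≤ originIdeal K ↔
      ∀ α : Fin 4 →₀ ℕ, 0 < α.degree → α.degree < q → coeff α F = 0 := by
  unfold singLocusIdeal
  rw [Ideal.span_le]
  constructor
  · intro h α h0 hq
    exact (hasseDeriv_mem_originIdeal_iff α F).mp (h ⟨α, h0, hq, rfl⟩)
  · rintro h G ⟨α, h0, hq, rfl⟩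
    exact (hasseDeriv_mem_originIdeal_iff α F).mpr (h α h0 hq)

/-- `q ≤ ord₀ F` iff every coefficient of `F` in degree `< q` vanishes. [folklore] -/
theorem le_ordAlong_univ_iff_coeff_eq_zero {q : ℕ} {F : MvPolynomial (Fin 4) K} :
    (q : ℕ∞) ≤ CentreBlowup.ordAlong Finset.univ F ↔
      ∀ α : Fin 4 →₀ ℕ, α.degree < q → coeff α F = 0 := by
  rw [CentreBlowup.le_ordAlong_iff]
  constructor
  · intro h α hα
    by_contra hne
    have h1 := h α (MvPolynomial.mem_support_iff.mpr hne)
    rw [CentreBlowup.degIn_univ] at h1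
    have h2 : q ≤ α.degree := by exact_mod_cast h1
    omega
  · intro h d hd
    rw [CentreBlowup.degIn_univ]
    have h1 : ¬ d.degree < q := fun hlt => (MvPolynomial.mem_support_iff.mp hd) (h d hlt)
    exact_mod_cast not_lt.mp h1

/-- For `F` without constant term (in particular for the cleaned `F` of a presented state),
`J_q⁺(F) ≤ 𝔪₀ ↔ q ≤ ord₀ F`: the first clause of `IsIsolated` is the `q`-fold-origin clause of
`Step0`. [folklore] -/
theorem singLocusIdeal_le_originIdeal_iff_le_ordAlong_univ {q : ℕ} {F : MvPolynomial (Fin 4) K}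
    (h0 : coeff 0 F = 0) :
    singLocusIdeal q F ≤ originIdeal K ↔ (q : ℕ∞) ≤ CentreBlowup.ordAlong Finset.univ F := by
  rw [singLocusIdeal_le_originIdeal_iff, le_ordAlong_univ_iff_coeff_eq_zero]
  constructor
  · intro h α hα
    by_cases hα0 : α.degree = 0
    · rwa [(Finsupp.degree_eq_zero_iff α).mp hα0]
    · exact h α (Nat.pos_of_ne_zero hα0) hα
  · exact fun h α _ hα => h α hα

end IsolatedScope

end Summit.ResolutionOfSingularities.ResolutionOfSingularities.Theorems.PIDim4
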